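import Literature.NumberTheory.EllipticCurves.LocalWeilPairingDuality
import Literature.NumberTheory.GaloisRepresentations.LocalDualityTheorem
import Summits.BirchSwinnertonDyer.Rank1Residual.GaloisImage.UnramifiedClassesIsotropic
import HarnessLib

/-!
# The `E[p]` instance of the N2 parity law, PART IV: the binder `hΛ` — the unramified classes
# `H¹_ur(K_v, E[p])` are their own annihilator under the local Weil cup product, at EVERY finite
# `v ∤ p` (ramified or not), modulo Tate's count `#H¹(K_v, E[p]) ≤ (#H¹_ur)²`
# (cell `b2b-bsdres`, unit `b2b-bsdres-x10` = N2 class lead, GEN 31; theorems only, no definition, no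
# named fact, nothing booked — glue G3/G3′ of `class-closure/N2/P-INSTANCE-ASK-x10g31.md`)

HONEST FRAMING (run/shared/lean/b2b/bsd-rank1-residual/, verbatim in every file): the goal of the
cell is to DELETE the COMBINATION-SHAPED residual classes of the Birch–Swinnerton-Dyer formula for
ALL analytic-rank `≤ 1` elliptic curves over `ℚ` — "full BSD formula for every rank `≤ 1` curve in
class `C`" assembled STRICTLY from published theorems — so that the rank-`≤ 1` remainder becomes
exactly the CONSTRUCTION-SHAPED classes, which are TYPED (missing-input `Prop`s), NOT attempted.
This is not "finishing BSD". Class X10b (= N2) keeps its label CONSTRUCTION-SHAPED (NEEDS `X_A3`,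
referee R82.3 / RESIDUAL-MAP §I N2); this file is a TOOL; no mark / label / tier / count moves.

## What

Klagsbrun–Mazur–Rubin 2013 Thm. 3.1 (ii) / Milne *ADT* I Thm. 2.6: "`H¹_ur(K_v, T)` is equal to its own
orthogonal complement under `⟨ , ⟩_v`". For the dictionary `b v x y = inv_v(x ∪_{e,v} y)` of
`X10/ResidualSelmerReciprocity` this is the binder `hΛ` of
`X10/ResidualSelmerParityGroupForm.even_add_add_card_groupForm` (with `Λ (Sum.inr v)` = the unramified
subgroup = `residualSelmerStructure W p (Sum.inr v)` at `v ∤ p`, `X10/ResidualSelmerGroup`). The proof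
here needs NO hypothesis that `E[p]` be unramified at `v` (so the ASK's G3′ — Milne I 2.6 for ramified
modules — dissolves): ISOTROPY of unramified classes holds for every pairing over a local field (team
n1011's `cupProduct_eq_zero_of_mem_unramifiedSubgroup`, `cd(Γ/I) = 1`), and MAXIMALITY is the tree's
counting lemma `forall_mem_apply_eq_zero_iff_of_isotropic_of_card_le` (`LocalWeilPairingDuality.lean`)
fed with local Tate duality for `E[p]` (`eq_zero_of_forall_weilCupProduct_eq_zero_inr`) and the COUNT
`#H¹(K_v, E[p]) ≤ (#H¹_ur(K_v, E[p]))²`, kept as the displayed binder `hcardΛ` (it is Milne I 2.6's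
count: `#H¹_ur = #H⁰`, `#H¹ = #H⁰ · #H²` by the prime-to-`p` Euler characteristic, `#H² = #H⁰(E[p]^D)
= #H⁰(E[p])` by local duality and the Weil self-duality — true for ramified `E[p]` as well).

* `hΛ_groupForm` — for `e` non-degenerate, `inv (Sum.inr v)` injective, and the
  count at `v`: `x ∈ H¹_ur ↔ ∀ y ∈ H¹_ur, b (Sum.inr v) x y = 0`.
* `hΛ_groupForm_of_forall` — the binder shape: for every finite `v` outside a set `S₀` (with the count
  there), quantified as the law wants it, the archimedean places being inside `S₀`.

## References

* [KlagsbrunMazurRubin2013] Thm. 3.1 (ii); [MilneADT2006] I Thm. 2.6, Cor. 2.3.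
* HOME/class-closure/N2/P-INSTANCE-ASK-x10g31.md (G3, G3′); HOME/X10-AUDIT.md §37.
-/

set_option autoImplicit false

noncomputable section

open scoped Classical

open Function WeierstrassCurve Field Literature.NumberTheory.EllipticCurves
  Literature.NumberTheory.GaloisRepresentations Literature.NumberTheory.GaloisCohomology NumberField
  IsDedekindDomain
open Literature.NumberTheory.GaloisRepresentations.DiscreteGaloisModule (mu unramifiedSubgroup)
open Summit.BirchSwinnertonDyer.Rank1Residual.GaloisImage.TwoLagrangianLines

namespace Summit.BirchSwinnertonDyer.Rank1Residual.X10.ResidualSelmerUnramifiedDuality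

-- Cup products need `LocallyCompactSpace Γ_{K_v}` (in the tree a LOCAL instance,
-- `absoluteGaloisGroup_compactSpace`); as in team n1011's files it is an instance HYPOTHESIS here.

variable {K : Type} [Field K] [NumberField K] (W : WeierstrassCurve K) (p : ℕ) [Fact p.Prime] [W.IsElliptic]
variable (e : geomTorsion W p → geomTorsion W p → AlgebraicClosure K)
  (hμ : ∀ S T, e S T ^ p = 1)
  (hadd₁ : ∀ S₁ S₂ T, e (S₁ + S₂) T = e S₁ T * e S₂ T)
  (hadd₂ : ∀ S T₁ T₂, e S (T₁ + T₂) = e S T₁ * e S T₂)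
  (hgal : ∀ (σ : absoluteGaloisGroup K) (S T : geomTorsion W p), σ • e S T = e (σ • S) (σ • T))

/-- **`hΛ` at one finite place — `H¹_ur(K_v, E[p])` is its own annihilator under
`b(x, y) = inv_v(x ∪_{e,v} y)`** (KMR Thm. 3.1 (ii) / Milne I Thm. 2.6, for `E[p]` ramified at `v` or not),
given `e` non-degenerate, `inv (Sum.inr v)` injective and the count `#H¹(K_v, E[p]) ≤ (#H¹_ur)²`.
[cite: KlagsbrunMazurRubin2013, Thm. 3.1 (ii)] [cite: MilneADT2006, Ch. I, Thm. 2.6] -/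
theorem hΛ_groupForm (v : HeightOneSpectrum (𝓞 K))
    [LocallyCompactSpace (absoluteGaloisGroup (Place.Completion (Sum.inr v : Place K)))]
    (hnondeg : ∀ T, (∀ S, e S T = 1) → T = 0) (inv : LocalInvariants K p)
    (hinj : Injective (inv (Sum.inr v)))
    (b : galoisCohomology ((W.torsionGaloisModule p).toLocal (Sum.inr v)) 1 →+
        galoisCohomology ((W.torsionGaloisModule p).toLocal (Sum.inr v)) 1 →+ ZMod p)
    (hb : ∀ x y, b x y =
      inv (Sum.inr v) ((weilContPairingLocal W p e hμ hadd₁ hadd₂ hgal (Sum.inr v)).cupProduct x y))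
    (hcardΛ : Nat.card (galoisCohomology ((W.torsionGaloisModule p).toLocal (Sum.inr v)) 1) ≤
      Nat.card (unramifiedSubgroup (GaloisRep.toLocal v (W.torsionGaloisModule p)) 1) *
        Nat.card (unramifiedSubgroup (GaloisRep.toLocal v (W.torsionGaloisModule p)) 1))
    (x : galoisCohomology ((W.torsionGaloisModule p).toLocal (Sum.inr v)) 1) :
    x ∈ unramifiedSubgroup (GaloisRep.toLocal v (W.torsionGaloisModule p)) 1 ↔
      ∀ y ∈ unramifiedSubgroup (GaloisRep.toLocal v (W.torsionGaloisModule p)) 1, b x y = 0 := by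
  haveI : LocallyCompactSpace (absoluteGaloisGroup (v.adicCompletion K)) :=
    ‹LocallyCompactSpace (absoluteGaloisGroup (Place.Completion (Sum.inr v : Place K)))›
  haveI : CharZero (v.adicCompletion K) := charZero_adicCompletion v
  haveI : Finite (geomTorsion W (p : ℤ)) := finite_geomTorsion_of_neZero W p
  haveI : Finite (galoisCohomology ((W.torsionGaloisModule p).toLocal (Sum.inr v)) 1) :=
    finite_galoisCohomology_one_of_isNonarchimedeanLocalField
      (GaloisRep.toLocal v (W.torsionGaloisModule (p : ℤ)))
  haveI : Finite (DiscreteGaloisModule.MuCarrier K p) := finite_muCarrier K p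
  -- `p · H¹ = 0`
  have hH : ∀ y : galoisCohomology ((W.torsionGaloisModule p).toLocal (Sum.inr v)) 1, p • y = 0 :=
    galoisCohomology.nsmul_eq_zero_of_forall _ fun m => AddSubgroup.torsionBy.nsmul m
  -- injectivity of the left adjoint: local Tate duality for `E[p]` + injectivity of `inv_v`
  have hbinj : Injective b := by
    refine (injective_iff_map_eq_zero _).mpr fun z hz => ?_
    refine eq_zero_of_forall_weilCupProduct_eq_zero_inr W p e hμ hadd₁ hadd₂ v hgal hnondeg z fun y => ?_
    exact hinj (by rw [← hb, hz, AddMonoidHom.zero_apply]; exact (map_zero (inv (Sum.inr v))).symm)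
  -- isotropy of the unramified classes (any pairing; `cd(Γ/I) = 1`)
  have hiso : ∀ z : galoisCohomology ((W.torsionGaloisModule p).toLocal (Sum.inr v)) 1,
      z ∈ unramifiedSubgroup (GaloisRep.toLocal v (W.torsionGaloisModule p)) 1 →
      ∀ y : galoisCohomology ((W.torsionGaloisModule p).toLocal (Sum.inr v)) 1,
        y ∈ unramifiedSubgroup (GaloisRep.toLocal v (W.torsionGaloisModule p)) 1 → b z y = 0 := by
    intro z hz y hy
    have h0 : (weilContPairingLocal W p e hμ hadd₁ hadd₂ hgal (Sum.inr v)).cupProduct z y = 0 :=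
      cupProduct_eq_zero_of_mem_unramifiedSubgroup
        (ρA := GaloisRep.toLocal v (W.torsionGaloisModule p))
        (ρB := GaloisRep.toLocal v (W.torsionGaloisModule p))
        (ρC := GaloisRep.toLocal v (mu K p))
        (weilContPairingLocal W p e hμ hadd₁ hadd₂ hgal (Sum.inr v)) hz hy
    rw [hb, h0]
    exact map_zero (inv (Sum.inr v))
  exact (forall_mem_apply_eq_zero_iff_of_isotropic_of_card_le b hH hbinj _ _ hiso hcardΛ x).symm

/-- **`hΛ` in the shape of the law**: for `Λ` any family of local subgroups that IS the unramified
subgroup at the finite places outside `S₀` (e.g. `residualSelmerStructure W p`, `X10/ResidualSelmerGroup`,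
with `S₀ ⊇ {v ∣ ∞} ∪ {v ∣ p}`), and `b v = inv_v(· ∪_{e,v} ·)`: for every `v ∉ S₀`,
`x ∈ Λ v ↔ ∀ y ∈ Λ v, b v x y = 0` — given the counts at those places and `inv` injective there.
[cite: KlagsbrunMazurRubin2013, Thm. 3.1 (ii)] -/
theorem hΛ_groupForm_of_forall [∀ v : Place K, LocallyCompactSpace (absoluteGaloisGroup (Place.Completion v))]
    (hnondeg : ∀ T, (∀ S, e S T = 1) → T = 0) (inv : LocalInvariants K p)
    (hinj : ∀ v : HeightOneSpectrum (𝓞 K), Injective (inv (Sum.inr v)))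
    (b : ∀ v : Place K, galoisCohomology ((W.torsionGaloisModule p).toLocal v) 1 →+
        galoisCohomology ((W.torsionGaloisModule p).toLocal v) 1 →+ ZMod p)
    (hb : ∀ v x y, b v x y = inv v ((weilContPairingLocal W p e hμ hadd₁ hadd₂ hgal v).cupProduct x y))
    (Λ : ∀ v : Place K, AddSubgroup (galoisCohomology ((W.torsionGaloisModule p).toLocal v) 1))
    {S₀ : Finset (Place K)} (hS₀ : ∀ w : InfinitePlace K, (Sum.inl w : Place K) ∈ S₀)
    (hΛ : ∀ v : HeightOneSpectrum (𝓞 K), (Sum.inr v : Place K) ∉ S₀ →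
      Λ (Sum.inr v) = unramifiedSubgroup (GaloisRep.toLocal v (W.torsionGaloisModule p)) 1)
    (hcardΛ : ∀ v : HeightOneSpectrum (𝓞 K), (Sum.inr v : Place K) ∉ S₀ →
      Nat.card (galoisCohomology ((W.torsionGaloisModule p).toLocal (Sum.inr v)) 1) ≤
        Nat.card (unramifiedSubgroup (GaloisRep.toLocal v (W.torsionGaloisModule p)) 1) *
          Nat.card (unramifiedSubgroup (GaloisRep.toLocal v (W.torsionGaloisModule p)) 1)) :
    ∀ v, v ∉ S₀ → ∀ x, x ∈ Λ v ↔ ∀ y ∈ Λ v, b v x y = 0 := by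
  rintro (w | v) hv x
  · exact absurd (hS₀ w) hv
  · rw [hΛ v hv]
    exact hΛ_groupForm W p e hμ hadd₁ hadd₂ hgal v hnondeg inv (hinj v) (b (Sum.inr v)) (hb (Sum.inr v))
      (hcardΛ v hv) x

end Summit.BirchSwinnertonDyer.Rank1Residual.X10.ResidualSelmerUnramifiedDuality

end
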